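import Summits.BirchSwinnertonDyer.BirchSwinnertonDyer.Theorems.PrintCf2SplitBadTwoFirstLayerOfFrame
import Summits.BirchSwinnertonDyer.BirchSwinnertonDyer.Theorems.PrintCf2SplitBadTwoRestrictedSelmerControlKernelExact
import Literature.NumberTheory.GaloisRepresentations.IntegralGaloisActionProofs
import Mathlib.NumberTheory.RamificationInertia.Inertia
import HarnessLib

/-!
# Crux `PrintCf2.SplitBadTwoRankOneOfFacts` (stmt-BirchSwinnertonDyer-20368), road α v10.2 — brick B15 §2, file 4:
# THE PLACE ABOVE `7` IS INERT IN THE FIRST LAYER of every `ℤ₂`-line of the frame field unramified outside `v̄` — (H7) discharged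

Cell `bsd-print-cf2`, width seat `bsd-line-cf2-p1-w6` g2 (prover-bsd-line-cf2-p1-w6-g2-0); `--supports stmt-BirchSwinnertonDyer-20368`
(helper, Theses-free). HONEST FRAMING: nothing here closes the crux or a registered stub; BSD is not proved by any of this; no summit
statement is proved by this seat. No definition, no named fact, no `sorry`.

WHAT. File 3b proved `κ⁻¹(2ℤ₂) = Stab(√−β)` for every `ℤ₂`-line `κ` of the frame field `K ∋ √−7` unramified outside `v̄` (`β ∈ v̄`,
`β(1−β) = 2`). Here: a Frobenius at the place `w₇ ∋ 7` MOVES `√−β`, so `w₇` does not split in the first layer — hypothesis (H7) of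
file 1 (`…RestrictedSelmerControlKernelExact`) holds on EVERY S3c₂ frame:
* §1 `natCard_quotient_eq_seven`: `#(𝓞_K ⧸ w₇) = 7` — `θ ∈ w₇` (`θ² = −7`) gives `e(w₇∣7) ≥ 2` (`intValuation_liesOver` over `ℤ`),
  the fundamental identity `∑ e f = 2` (Mathlib `Ideal.sum_ramification_inertia`) gives `f = 1`, and `N(w₇) = 7^f`
  (`Ideal.absNorm_eq_pow_inertiaDeg'`);
* §2 `pow_three_sub_one_mem`: `β ≡ 4 (mod w₇)` (`(β − 4)² = −7(β − 2)`), hence `β³ − 1 ∈ w₇` and `(−β)³ ≡ −1`: `−β` is a cubic =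
  quadratic NON-residue (`(q−1)/2 = 3`);
* §3 **`exists_mem_decomp_smul_geomSqrt_neg_eq_neg`**: an arithmetic Frobenius `σ` at `𝔓₀ = adicCompletionPrime K w₇` (tree
  `exists_isArithFrobAt_of_mem_primesAbove_holds`; `σ ∈ D_{𝔓₀} = decomp w₇` by Mathlib `IsArithFrobAt.mem_stabilizer` and the tree's
  `decompositionSubgroup_adicCompletionPrime_eq_range`) satisfies `σ√−β ≡ (√−β)⁷ = (−β)³ √−β ≡ −√−β (mod 𝔓₀)`, and `σ√−β = √−β` would put
  `2√−β`, hence `4β`, in `𝔓₀ ∩ 𝓞_K = w₇` — impossible (`β(1−β) = 2`, `7 ∈ w₇`); so `σ√−β = −√−β`;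
* §4 **`not_decomp_seven_le_layerSubgroup_one_of_frame`** — (H7) — and **`ker_control_of_frame_eq_bot_unconditional`**: on every S3c₂ frame
  the kernel term of the control identity is `0`, with NO hypothesis left (file 1 + (H7)); `natCard …= 1`, `padicValNat … = 0`.
presearch: Neukirch ANT I (8.3)/(9.4) (decomposition law via Frobenius), Marcus Ch. 3 Thm. 25, Cox §7 — held; no new Literature fact.
beyond-print theorem: no.

References: [NeukirchANT1999] Ch. I §8 Prop. (8.3), §9 Prop. (9.4), Ch. II §9 (9.6); [Marcus2018] Ch. 3 Thm. 25; [SerreAbelianLadic1968]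
Ch. I §2.1; [Agboola2007] §3 Prop. 3.2.
-/

noncomputable section

open scoped Classical NumberField Pointwise

set_option linter.dupNamespace false
set_option autoImplicit false

open NumberField IsDedekindDomain Field WeierstrassCurve
open Literature.NumberTheory Literature.NumberTheory.EllipticCurves Literature.NumberTheory.GaloisRepresentations

namespace Summit.BirchSwinnertonDyer.BirchSwinnertonDyer.Theorems.PrintCf2.FirstLayer

variable {K : Type} [Field K] [NumberField K]

/-! ## §1. The residue field at the place above `7` has `7` elements -/

section Seven

omit [NumberField K] in
/-- `θ` with `θ² = −7` is an algebraic integer: some `t ∈ 𝓞_K` has `t = θ` and `t² = −7`. [folklore] -/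
theorem exists_ringOfIntegers_sq_eq_neg_seven {θ : K} (hθ : θ ^ 2 = -7) : ∃ t : 𝓞 K, (t : K) = θ ∧ t * t = -7 := by
  have hint : _root_.IsIntegral ℤ θ := by
    refine ⟨Polynomial.X ^ 2 + Polynomial.C 7, ?_, ?_⟩
    · exact (Polynomial.monic_X_pow 2).add_of_left (by rw [Polynomial.degree_C (by norm_num), Polynomial.degree_X_pow]; norm_num)
    · rw [Polynomial.eval₂_add, Polynomial.eval₂_pow, Polynomial.eval₂_X, Polynomial.eval₂_C, hθ]
      simp
  refine ⟨⟨θ, hint⟩, rfl, ?_⟩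
  apply RingOfIntegers.ext
  push_cast
  change θ * θ = -7
  rw [← sq, hθ]

/-- **`#(𝓞_K ⧸ w₇) = 7`** for the place `w₇ ∋ 7` of an imaginary quadratic field containing `√−7`: `e(w₇ ∣ 7) ≥ 2` (as `7 = −θ²` with
`θ ∈ w₇`), so the fundamental identity `∑ e·f = [K:ℚ] = 2` forces `f(w₇ ∣ 7) = 1` and `N(w₇) = 7`.
[cite: NeukirchANT1999, Ch. I §8 Prop. (8.2)] [cite: Marcus2018, Ch. 3 Thm. 25] -/
theorem natCard_quotient_eq_seven (hK : IsImaginaryQuadratic K) {θ : K} (hθ : θ ^ 2 = -7) {w : HeightOneSpectrum (𝓞 K)}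
    (h7 : ((7 : ℕ) : 𝓞 K) ∈ w.asIdeal) : Nat.card (𝓞 K ⧸ w.asIdeal) = 7 := by
  obtain ⟨t, -, ht⟩ := exists_ringOfIntegers_sq_eq_neg_seven hθ
  -- the prime `(7)` of `ℤ` below `w`
  have h7prime : Prime (7 : ℤ) := Int.prime_iff_natAbs_prime.mpr (by norm_num)
  set p7 : Ideal ℤ := Ideal.span {(7 : ℤ)} with hp7def
  haveI hp7max : p7.IsMaximal := PrincipalIdealRing.isMaximal_of_irreducible h7prime.irreducible
  have hp7ne : p7 ≠ ⊥ := by rw [hp7def, Ne, Ideal.span_singleton_eq_bot]; norm_num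
  haveI hover : w.asIdeal.LiesOver p7 := by
    refine ⟨(hp7max.eq_of_le (Ideal.IsPrime.ne_top inferInstance) ?_)⟩
    rw [hp7def, Ideal.span_le, Set.singleton_subset_iff]
    change algebraMap ℤ (𝓞 K) 7 ∈ w.asIdeal
    rw [map_ofNat]
    exact_mod_cast h7
  let v7 : HeightOneSpectrum ℤ := ⟨p7, hp7max.isPrime, hp7ne⟩
  haveI : w.asIdeal.LiesOver v7.asIdeal := hover
  -- `e(w ∣ 7) ≥ 2`
  have he2 : 2 ≤ Ideal.ramificationIdx' p7 w.asIdeal := by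
    have hval := HeightOneSpectrum.intValuation_liesOver v7 w (7 : ℤ)
    have h7v : v7.intValuation (7 : ℤ) = WithZero.exp (-1 : ℤ) := v7.intValuation_singleton (by norm_num) rfl
    rw [h7v, map_ofNat, ← WithZero.exp_nsmul] at hval
    have htw : t ∈ w.asIdeal := by
      have : t * t ∈ w.asIdeal := by
        rw [ht]
        have h := w.asIdeal.neg_mem h7
        exact_mod_cast h
      exact (w.isPrime.mem_or_mem this).elim id id
    have ht1 : w.intValuation t ≤ WithZero.exp (-((1 : ℕ) : ℤ)) := by
      rw [HeightOneSpectrum.intValuation_le_pow_iff_mem, pow_one]; exact htw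
    have h7t : w.intValuation (7 : 𝓞 K) = w.intValuation t * w.intValuation t := by
      rw [← map_mul, ht, Valuation.map_neg]
    have hle : w.intValuation (7 : 𝓞 K) ≤ WithZero.exp (-2 : ℤ) := by
      rw [h7t, show (-2 : ℤ) = -((1 : ℕ) : ℤ) + -((1 : ℕ) : ℤ) by norm_num, WithZero.exp_add]
      exact mul_le_mul' ht1 ht1
    change 2 ≤ Ideal.ramificationIdx' v7.asIdeal w.asIdeal
    rw [← hval, WithZero.exp_le_exp] at hle
    simp only [smul_neg, nsmul_eq_mul, mul_one] at hle
    omega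
  -- the fundamental identity `∑ e f = 2`
  haveI : Module.Free ℤ (𝓞 K) := inferInstance
  have hsum := Ideal.sum_ramification_inertia (R := ℤ) (S := 𝓞 K) ℚ K (p := p7) hp7ne
  have hmem : w.asIdeal ∈ IsDedekindDomain.primesOverFinset p7 (𝓞 K) :=
    (IsDedekindDomain.mem_primesOverFinset_iff hp7ne _).mpr ⟨w.isPrime, hover⟩
  have hle : Ideal.ramificationIdx' p7 w.asIdeal * Ideal.inertiaDeg' p7 w.asIdeal ≤ 2 := by
    rw [← hK.1, ← hsum]
    exact Finset.single_le_sum (f := fun P ↦ Ideal.ramificationIdx' p7 P * Ideal.inertiaDeg' p7 P) (fun _ _ ↦ Nat.zero_le _) hmem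
  have hf1 : Ideal.inertiaDeg' p7 w.asIdeal ≤ 1 := by
    by_contra h
    have : 2 * 2 ≤ Ideal.ramificationIdx' p7 w.asIdeal * Ideal.inertiaDeg' p7 w.asIdeal := Nat.mul_le_mul he2 (by omega)
    omega
  -- `N(w) = 7 ^ f`
  have hnorm := Ideal.absNorm_eq_pow_inertiaDeg' w.asIdeal (p := 7) (by norm_num)
  have hgt : 1 < Ideal.absNorm w.asIdeal := NumberField.HeightOneSpectrum.one_lt_absNorm w
  have hf : Ideal.inertiaDeg' p7 w.asIdeal = 1 := by
    rcases Nat.le_one_iff_eq_zero_or_eq_one.mp hf1 with h0 | h1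
    · rw [hp7def] at h0
      simp only [Nat.cast_ofNat] at hnorm
      rw [h0, pow_zero] at hnorm
      omega
    · exact h1
  simp only [Nat.cast_ofNat] at hnorm
  rw [hp7def] at hf
  rw [← HeightOneSpectrum.residueCard_eq_card_quotient]
  change Ideal.absNorm w.asIdeal = 7
  rw [hnorm, hf, pow_one]

end Seven

/-! ## §2. `β ≡ 4 (mod w₇)`, so `β³ ≡ 1` and `(−β)³ ≡ −1` -/

section Residue

variable {β : 𝓞 K} {w : HeightOneSpectrum (𝓞 K)}

omit [NumberField K] in
/-- `β ≡ 4 (mod w₇)`: `(β − 4)² = −7(β − 2)` when `β(1−β) = 2`. [folklore] -/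
theorem sub_four_mem (hβ : β * (1 - β) = 2) (h7 : ((7 : ℕ) : 𝓞 K) ∈ w.asIdeal) : β - 4 ∈ w.asIdeal := by
  have hsq : (β - 4) * (β - 4) = -(7 * (β - 2)) := by linear_combination (-1 : 𝓞 K) * hβ
  have hmem : (β - 4) * (β - 4) ∈ w.asIdeal := by
    rw [hsq]
    exact w.asIdeal.neg_mem (w.asIdeal.mul_mem_right _ (by exact_mod_cast h7))
  exact (w.isPrime.mem_or_mem hmem).elim id id

omit [NumberField K] in
/-- `β³ − 1 ∈ w₇` (`4³ = 64 ≡ 1 (mod 7)`): `(−β)^{(7−1)/2} ≡ −1`, i.e. `−β` is a quadratic non-residue at `w₇`. [folklore] -/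
theorem pow_three_sub_one_mem (hβ : β * (1 - β) = 2) (h7 : ((7 : ℕ) : 𝓞 K) ∈ w.asIdeal) : β ^ 3 - 1 ∈ w.asIdeal := by
  have h := sub_four_mem hβ h7
  have e : β ^ 3 - 1 = (β - 4) * (β ^ 2 + 4 * β + 16) + 7 * 9 := by ring
  rw [e]
  exact w.asIdeal.add_mem (w.asIdeal.mul_mem_right _ h) (w.asIdeal.mul_mem_right _ (by exact_mod_cast h7))

omit [NumberField K] in
/-- `4β ∉ w₇` (`β` is a unit at `w₇ ∌ 2`). [folklore] -/
theorem four_mul_notMem (hβ : β * (1 - β) = 2) (h7 : ((7 : ℕ) : 𝓞 K) ∈ w.asIdeal) : 4 * β ∉ w.asIdeal := by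
  intro h
  have h2 : ((2 : ℕ) : 𝓞 K) ∉ w.asIdeal := AdditiveAtSeven.natCast_two_notMem_of_seven_mem w h7
  rcases w.isPrime.mem_or_mem h with h4 | hb
  · apply h2
    have : (4 : 𝓞 K) = 2 * 2 := by norm_num
    rw [this] at h4
    have h2' := (w.isPrime.mem_or_mem h4).elim id id
    exact_mod_cast h2'
  · apply h2
    have : (2 : 𝓞 K) ∈ w.asIdeal := by rw [← hβ]; exact w.asIdeal.mul_mem_right _ hb
    exact_mod_cast this

end Residue

/-! ## §3. A Frobenius at `w₇` moves `√−β` -/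

section Frobenius

/-- **A Frobenius at the place above `7` sends `√−β ↦ −√−β`** (`K` imaginary quadratic with `θ² = −7`, `β(1−β) = 2`, `7 ∈ w`): for an
arithmetic Frobenius `σ ∈ Γ_K` at `𝔓₀ = adicCompletionPrime K w` — which lies in `decomp w = D_{𝔓₀}` — one has
`σ√−β ≡ (√−β)^{N w} = (√−β)⁷ = (−β)³·√−β ≡ −√−β (mod 𝔓₀)`, and `σ√−β = +√−β` would give `2√−β ∈ 𝔓₀`, `4β ∈ 𝔓₀ ∩ 𝓞_K = w`.
[cite: NeukirchANT1999, Ch. I §8 Prop. (8.3) and §9 Prop. (9.4)] [cite: SerreAbelianLadic1968, Ch. I §2.1] -/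
theorem exists_mem_decomp_smul_geomSqrt_neg_eq_neg (hK : IsImaginaryQuadratic K) {θ : K} (hθ : θ ^ 2 = -7) {β : 𝓞 K}
    (hβ : β * (1 - β) = 2) {w : HeightOneSpectrum (𝓞 K)} (h7 : ((7 : ℕ) : 𝓞 K) ∈ w.asIdeal) :
    ∃ δ ∈ GreenbergSelmer.decomp w, δ • geomSqrt (-(β : K)) = -geomSqrt (-(β : K)) := by
  set 𝔓 := adicCompletionPrime K w with h𝔓def
  have h𝔓 : 𝔓 ∈ w.primesAbove := adicCompletionPrime_mem_primesAbove K w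
  obtain ⟨σ, hσ⟩ := HeightOneSpectrum.exists_isArithFrobAt_of_mem_primesAbove_holds (K := K) (v := w) h𝔓
  -- `σ ∈ decomp w`
  have hσD : σ ∈ GreenbergSelmer.decomp w := by
    have hstab : σ ∈ MulAction.stabilizer (absoluteGaloisGroup K) 𝔓 := hσ.mem_stabilizer
    have e : GreenbergSelmer.decomp w = 𝔓.decompositionSubgroup (absoluteGaloisGroup K) := by
      rw [h𝔓def, decompositionSubgroup_adicCompletionPrime_eq_range]; rfl
    rw [e]
    exact hstab
  refine ⟨σ, hσD, ?_⟩
  -- `x = √−β` as an element of `\bar ℤ_K`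
  set x : AlgebraicClosure K := geomSqrt (-(β : K)) with hxdef
  have hx2 : x ^ 2 = algebraMap (𝓞 K) (AlgebraicClosure K) (-β) := by
    rw [hxdef, geomSqrt_sq, IsScalarTower.algebraMap_apply (𝓞 K) K (AlgebraicClosure K)]
    push_cast
    rfl
  have hxint : x ∈ absIntegers (𝓞 K) K := by
    rw [absIntegers, mem_integralClosure_iff]
    exact IsIntegral.of_pow two_pos (by rw [hx2]; exact isIntegral_algebraMap)
  set X : absIntegers (𝓞 K) K := ⟨x, hxint⟩ with hXdef
  -- the Frobenius congruence `σ X - X ^ 7 ∈ 𝔓`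
  have hq : w.residueCard = 7 := by
    rw [HeightOneSpectrum.residueCard_eq_card_quotient]; exact natCard_quotient_eq_seven hK hθ h7
  have hfrob : σ • X - X ^ 7 ∈ 𝔓 := by
    have h := (HeightOneSpectrum.isArithFrobAt_iff_of_mem_primesAbove h𝔓 σ).mp hσ X
    rwa [hq] at h
  -- `X ^ 7 + X ∈ 𝔓` since `X² = −β` and `β³ ≡ 1 (mod w)`
  have hmemP : ∀ y : 𝓞 K, y ∈ w.asIdeal → algebraMap (𝓞 K) (absIntegers (𝓞 K) K) y ∈ 𝔓 := fun y hy ↦ by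
    have h : y ∈ 𝔓.under (𝓞 K) := by rw [under_adicCompletionPrime]; exact hy
    exact h
  have hX2 : X ^ 2 = algebraMap (𝓞 K) (absIntegers (𝓞 K) K) (-β) := by
    apply Subtype.ext
    change x ^ 2 = algebraMap (𝓞 K) (AlgebraicClosure K) (-β)
    exact hx2
  have h7X : X ^ 7 + X ∈ 𝔓 := by
    have e : X ^ 7 + X = -(X * algebraMap (𝓞 K) (absIntegers (𝓞 K) K) (β ^ 3 - 1)) := by
      rw [map_sub, map_pow, map_one, show X ^ 7 = X * (X ^ 2) ^ 3 by ring, hX2, map_neg]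
      ring
    rw [e]
    exact 𝔓.neg_mem (𝔓.mul_mem_left _ (hmemP _ (pow_three_sub_one_mem hβ h7)))
  have hsum : σ • X + X ∈ 𝔓 := by
    have e : σ • X + X = (σ • X - X ^ 7) + (X ^ 7 + X) := by ring
    rw [e]
    exact 𝔓.add_mem hfrob h7X
  -- exclude `σ x = x`
  rcases smul_geomSqrt_eq_or σ (-(β : K)) with hfix | hneg
  · exfalso
    have h2X : (2 : absIntegers (𝓞 K) K) * X ∈ 𝔓 := by
      have e : (2 : absIntegers (𝓞 K) K) * X = σ • X + X := by
        rw [two_mul]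
        congr 1
        apply Subtype.ext
        change x = σ • x
        exact hfix.symm
      rw [e]; exact hsum
    have h4β : algebraMap (𝓞 K) (absIntegers (𝓞 K) K) (4 * β) ∈ 𝔓 := by
      have e : algebraMap (𝓞 K) (absIntegers (𝓞 K) K) (4 * β) = -((2 * X) * (2 * X)) := by
        rw [show (2 * X) * (2 * X) = 4 * X ^ 2 by ring, hX2, map_mul, map_neg]
        simp only [map_ofNat]
        ring
      rw [e]
      exact 𝔓.neg_mem (𝔓.mul_mem_left _ h2X)
    have h4β' : 4 * β ∈ 𝔓.under (𝓞 K) := h4β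
    rw [under_adicCompletionPrime] at h4β'
    exact four_mul_notMem hβ h7 h4β'
  · exact hneg

end Frobenius

/-! ## §4. (H7) discharged: `w₇` does not split in the first layer; the kernel of control is `⊥` on every frame -/

section Frame

open Summit.BirchSwinnertonDyer.BirchSwinnertonDyer.Theorems.PrintCf2.AdditiveAtSeven

/-- **(H7) HOLDS ON EVERY FRAME.** `K` imaginary quadratic with `θ² = −7`, a member `C • W = cm7^{(d)}` (for `e(v∣2) = 1`), `2 = v v̄`,
`κ` ANY `ℤ₂`-extension of `K` unramified outside `v̄`, `w₇ ∋ 7`: **the decomposition group at `w₇` is not contained in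
`κ⁻¹(2ℤ₂)`** — `w₇` is inert in the first layer `K(√−β)` (files 3a/3b + §3). [cite: NeukirchANT1999, Ch. I §8 Prop. (8.3)]
[cite: Washington1997, §13.1] -/
theorem not_decomp_seven_le_layerSubgroup_one_of_frame (hK : IsImaginaryQuadratic K) {θ : K} (hθ : θ ^ 2 = -7) {d : ℤ}
    (hd0 : d ≠ 0) (W : WeierstrassCurve ℚ) [W.IsElliptic] {C : VariableChange ℚ} (hC : C • W = cm7.quadraticTwist (d : ℚ))
    {v vbar : HeightOneSpectrum (𝓞 K)} (hv : ((2 : ℕ) : 𝓞 K) ∈ v.asIdeal) (hvbar : ((2 : ℕ) : 𝓞 K) ∈ vbar.asIdeal)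
    (hne : vbar ≠ v) (κ : ZpExtension K 2) (hκ : κ.IsUnramifiedOutside vbar) {w : HeightOneSpectrum (𝓞 K)}
    (h7 : ((7 : ℕ) : 𝓞 K) ∈ w.asIdeal) : ¬ GreenbergSelmer.decomp w ≤ κ.layerSubgroup 1 := by
  obtain ⟨β, hβ, hβvbar⟩ := exists_mul_one_sub_eq_two_mem hθ hvbar
  obtain ⟨δ, hδ, hδβ⟩ := exists_mem_decomp_smul_geomSqrt_neg_eq_neg hK hθ hβ h7
  have hβ0 : (-(β : K)) ≠ 0 := by
    rw [neg_ne_zero]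
    intro h
    have hb : β = 0 := by exact_mod_cast h
    rw [hb, zero_mul] at hβ
    exact two_ne_zero hβ.symm
  refine not_decomp_le_layerSubgroup_one_of_exists_smul_ne hK hθ hd0 W hC hv hvbar hne hβ hβvbar κ hκ ⟨δ, hδ, ?_⟩
  rw [hδβ]
  exact (geomSqrt_ne_neg hβ0).symm

end Frame

end Summit.BirchSwinnertonDyer.BirchSwinnertonDyer.Theorems.PrintCf2.FirstLayer

/-! ## §5. The kernel term of S3c₂'s control identity is `0` on EVERY frame — no hypothesis left -/

namespace Summit.BirchSwinnertonDyer.BirchSwinnertonDyer.Theorems.PrintCf2.RestrictedSelmerPair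

open Literature.NumberTheory.EllipticCurves.GreenbergSelmer Literature.NumberTheory.EllipticCurves.Agboola2007
open Literature.NumberTheory.EllipticCurves.IwasawaDual
open Summit.BirchSwinnertonDyer.BirchSwinnertonDyer.Theorems.PrintCf2.AdditiveAtSeven
open Summit.BirchSwinnertonDyer.BirchSwinnertonDyer.Theorems.PrintCf2.FirstLayer

variable {K : Type} [Field K] [NumberField K]

/-- **ROAD α, UNCONDITIONAL: THE KERNEL OF CONTROL IS `⊥` ON EVERY S3c₂ FRAME** (member `C • W = cm7^{(d)}`, `K` imaginary quadratic,
`2 = v v̄` with `v ≠ v̄`, `π ∈ End_K(E_K)` with `π² = π − 2`, `r² = r − 2`, `κ′` ANY `ℤ₂`-extension unramified outside `v̄` — exactly the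
binders of `stub_restrictedEulerCharBottom_two`): `𝔖_{v̄}(K, W*) ⊓ ker (res : H¹(K, W*) → H¹(K*_∞, W*)) = ⊥`. File 1's
`ker_control_of_frame_eq_bot` with its hypothesis (H7) DISCHARGED by `not_decomp_seven_le_layerSubgroup_one_of_frame` (`√−7 ∈ K` from
the `K`-rational `π`, -w3 g7). LEAD p656507 had `#ker ≤ 2`. [cite: Agboola2007, §3 Prop. 3.2 (arXiv p0008:L128–135, L197)]
[cite: GreenbergLNM1716, §3 Lemmas 3.1 and 3.3] -/
theorem ker_control_of_frame_eq_bot_unconditional {d : ℤ} (hd0 : d ≠ 0) (W : WeierstrassCurve ℚ) [W.IsElliptic]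
    (C : VariableChange ℚ) (hC : C • W = cm7.quadraticTwist (d : ℚ)) (hK : IsImaginaryQuadratic K)
    (v vbar : HeightOneSpectrum (𝓞 K)) (hv : ((2 : ℕ) : 𝓞 K) ∈ v.asIdeal) (hvbar : ((2 : ℕ) : 𝓞 K) ∈ vbar.asIdeal)
    (hne : vbar ≠ v) (π : (W.baseChange K).endRing) (hrel : (π : AddMonoid.End (W.baseChange K).geomPoints) * π = π - 2)
    {r : ℤ_[2]} (hr : r * r = r - 2) (κ' : ZpExtension K 2) (hκ' : κ'.IsUnramifiedOutside vbar) :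
    restrictedSelmerBase ↥((W.baseChange K).endEigenPrimaryTorsion 2 π r) 2 vbar ⊓
      (resOfLe ↥((W.baseChange K).endEigenPrimaryTorsion 2 π r) (le_top : κ'.kerSubgroup ≤ ⊤)).ker = ⊥ := by
  have hj : W.j = -3375 := j_eq_of_smul_eq_cm7Twist hd0 W C hC
  obtain ⟨θ, hθ⟩ := exists_sq_eq_neg_seven_of_cmEndo_mem_endRing W K hj π hrel
  obtain ⟨w, h7⟩ := AdditiveAtSeven.exists_heightOneSpectrum_natCast_mem (K := K) (q := 7) (by norm_num)
  exact ker_control_of_frame_eq_bot hd0 W C hC hK vbar hvbar π hrel hr κ' hκ' h7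
    (not_decomp_seven_le_layerSubgroup_one_of_frame hK hθ hd0 W hC hv hvbar hne κ' hκ' h7)

/-- **`#ker = 1`, `v₂ #ker = 0` on every S3c₂ frame, unconditionally.** [cite: Agboola2007, §3 Prop. 3.2 (arXiv p0008:L197)] -/
theorem natCard_ker_control_of_frame_eq_one_unconditional {d : ℤ} (hd0 : d ≠ 0) (W : WeierstrassCurve ℚ) [W.IsElliptic]
    (C : VariableChange ℚ) (hC : C • W = cm7.quadraticTwist (d : ℚ)) (hK : IsImaginaryQuadratic K)
    (v vbar : HeightOneSpectrum (𝓞 K)) (hv : ((2 : ℕ) : 𝓞 K) ∈ v.asIdeal) (hvbar : ((2 : ℕ) : 𝓞 K) ∈ vbar.asIdeal)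
    (hne : vbar ≠ v) (π : (W.baseChange K).endRing) (hrel : (π : AddMonoid.End (W.baseChange K).geomPoints) * π = π - 2)
    {r : ℤ_[2]} (hr : r * r = r - 2) (κ' : ZpExtension K 2) (hκ' : κ'.IsUnramifiedOutside vbar) :
    Nat.card ↥(restrictedSelmerBase ↥((W.baseChange K).endEigenPrimaryTorsion 2 π r) 2 vbar ⊓
        (resOfLe ↥((W.baseChange K).endEigenPrimaryTorsion 2 π r) (le_top : κ'.kerSubgroup ≤ ⊤)).ker) = 1 ∧
      padicValNat 2 (Nat.card ↥(restrictedSelmerBase ↥((W.baseChange K).endEigenPrimaryTorsion 2 π r) 2 vbar ⊓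
        (resOfLe ↥((W.baseChange K).endEigenPrimaryTorsion 2 π r) (le_top : κ'.kerSubgroup ≤ ⊤)).ker)) = 0 := by
  have h := ker_control_of_frame_eq_bot_unconditional hd0 W C hC hK v vbar hv hvbar hne π hrel hr κ' hκ'
  have h1 : Nat.card ↥(restrictedSelmerBase ↥((W.baseChange K).endEigenPrimaryTorsion 2 π r) 2 vbar ⊓
      (resOfLe ↥((W.baseChange K).endEigenPrimaryTorsion 2 π r) (le_top : κ'.kerSubgroup ≤ ⊤)).ker) = 1 := by
    rw [h, AddSubgroup.card_bot]
  exact ⟨h1, by rw [h1, padicValNat_one_right]⟩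

/-- **S3c₂'s control identity with the `𝔖_Γ` term AND the kernel term gone, the latter UNCONDITIONALLY** (LEAD g11's
`control_identity_of_frame_of_noFiniteSubmodule`, p657357, with `v₂ #ker = 0` proved): on every frame over `K ∋ √−7` with both places
`v ≠ v̄` above `2` displayed and a dual datum `D` (finitely generated, `HasCharValuationAt n`, no nonzero finite `Λ`-submodule):
`#𝔖_Γ = 1`, `#ker = 1`, and **`n = v₂ #𝔖_{v̄}(K, W*) + v₂ [𝔖_{v̄}(K*_∞, W*)^Γ : res 𝔖_{v̄}(K, W*)]`**.
[cite: Agboola2007, §3 Prop. 3.2, §5, §6, Prop. 8.1] [cite: GreenbergLNM1716, §4 Lemma 4.2, Prop. 4.15] -/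
theorem control_identity_of_frame_of_noFiniteSubmodule_kerFree {d : ℤ} (hd0 : d ≠ 0) (W : WeierstrassCurve ℚ) [W.IsElliptic]
    (C : VariableChange ℚ) (hC : C • W = cm7.quadraticTwist (d : ℚ)) (hK : IsImaginaryQuadratic K) {θ : K} (hθ : θ ^ 2 = -7)
    (v vbar : HeightOneSpectrum (𝓞 K)) (hv : ((2 : ℕ) : 𝓞 K) ∈ v.asIdeal) (hvbar : ((2 : ℕ) : 𝓞 K) ∈ vbar.asIdeal) (hne : vbar ≠ v)
    (π : (W.baseChange K).endRing) (hrel : (π : AddMonoid.End (W.baseChange K).geomPoints) * π = π - 2)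
    {r : ℤ_[2]} (hr : r * r = r - 2) (κ' : ZpExtension K 2) (hκ' : κ'.IsUnramifiedOutside vbar)
    {γ' : absoluteGaloisGroup K} (hγ' : κ'.IsTopGenerator γ')
    (D : RestrictedDualData κ' ↥((W.baseChange K).endEigenPrimaryTorsion 2 π r) vbar γ')
    [Module.Finite (IwasawaAlgebra 2) D.X] {n : ℕ} (hD : D.HasCharValuationAt n)
    (hY : ∀ N : Submodule (IwasawaAlgebra 2) D.X, Finite N → N = ⊥) :
    Nat.card (EndCoinvariants (conjRestricted κ' ↥((W.baseChange K).endEigenPrimaryTorsion 2 π r) vbar γ' - 1)) = 1 ∧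
    Nat.card ↥(restrictedSelmerBase ↥((W.baseChange K).endEigenPrimaryTorsion 2 π r) 2 vbar ⊓
        (resOfLe ↥((W.baseChange K).endEigenPrimaryTorsion 2 π r) (le_top : κ'.kerSubgroup ≤ ⊤)).ker) = 1 ∧
      (n : ℕ) =
        padicValNat 2 (Nat.card (restrictedSelmerBase ↥((W.baseChange K).endEigenPrimaryTorsion 2 π r) 2 vbar)) +
          padicValNat 2 ((((restrictedSelmerBase ↥((W.baseChange K).endEigenPrimaryTorsion 2 π r) 2 vbar).map
              (resOfLe ↥((W.baseChange K).endEigenPrimaryTorsion 2 π r) (le_top : κ'.kerSubgroup ≤ ⊤))).addSubgroupOf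
              (restrictedSelmerZp κ' ↥((W.baseChange K).endEigenPrimaryTorsion 2 π r) vbar)).relIndex
            (endInvariants (conjRestricted κ' ↥((W.baseChange K).endEigenPrimaryTorsion 2 π r) vbar γ' - 1))) := by
  obtain ⟨w, h7⟩ := AdditiveAtSeven.exists_heightOneSpectrum_natCast_mem (K := K) (q := 7) (by norm_num)
  exact control_identity_of_frame_of_not_decomp_le hd0 W C hC hK hθ vbar hvbar π hrel hr κ' hκ' hγ' D hD hY h7
    (not_decomp_seven_le_layerSubgroup_one_of_frame hK hθ hd0 W hC hv hvbar hne κ' hκ' h7)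

end Summit.BirchSwinnertonDyer.BirchSwinnertonDyer.Theorems.PrintCf2.RestrictedSelmerPair

end
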